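import Summits.CriticalPhenomena.PercolationContinuityZ3.Theorems.PercNearOneGluingNoHeavyLowerTailMajorityGluingQCertSym3CountKey
import HarnessLib

/-!
# Type-space checker, steps 3b/3c/3e: merged tables, one-varying-slot sums, and the mask ↔ cylinder bridges (lane prim-rate, constants-miner 1, gen 37 → 38)

Support file for the closed crux `NoHeavyLowerTail` (stmt-CriticalPhenomena-4575), majority-gluing line (census/g37/TYPE-SPACE-CHECKER.md).
* `stepU`/`tabM`: the relay-by-relay table with equal codes MERGED after every relay (`aggr ∘ msort2`) evaluates like the unmerged `tabU` (`evalC_tabM`) — this is the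
  table the kernel checker will build (size ≤ the number of count vectors);
* `fixSum_eq_evalC_tabF`: the ONE-varying-slot counting lemma (`Σ_{K ∈ cylR n A X} g(cvcode Bs n K a b)`, fixed `a`, `b`) for the multiplier and marginal entries;
* bridges from the enumeration lists of `…QCertSym3` to cylinders: `cylMem_eq_cylB`, `suppOf_mask_eq_cylR` (a validated row mask lists exactly `cylR m A X`),
  `suppOf_marg_eq_cylR` (patterns containing relay `x` = `cylR m 0 2^x`), `cylR_zero_zero` (all patterns).
No sorries.
-/

namespace Summit.CriticalPhenomena.PercolationContinuityZ3.Theorems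

namespace HubOnly
namespace QCert

/-! ### Merged tables -/

/-- One relay step of a table: every entry branches over the allowed cells. -/
def stepU (Bs : ℕ) (cells : List ℕ) (l : List (ℕ × ℤ)) : List (ℕ × ℤ) := l.flatMap fun e => cells.map fun v => (e.1 + Bs ^ v, e.2)

/-- Evaluation of one step: `Σ_{v ∈ cells} evalC (g (· + Bs^v)) l`. -/
theorem evalC_stepU (Bs : ℕ) (cells : List ℕ) (g : ℕ → ℝ) (l : List (ℕ × ℤ)) :
    evalC g (stepU Bs cells l) = (cells.map fun v => evalC (fun c => g (c + Bs ^ v)) l).sum := by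
  unfold stepU
  rw [evalC_flatMap]
  induction l with
  | nil => simp [evalC]
  | cons e l ih =>
    rw [List.map_cons, List.sum_cons, ih]
    have h1 : evalC g (cells.map fun v => (e.1 + Bs ^ v, e.2)) = (cells.map fun v => (e.2 : ℝ) * g (e.1 + Bs ^ v)).sum := by
      unfold evalC; rw [List.map_map]; rfl
    have h2 : ∀ v : ℕ, evalC (fun c => g (c + Bs ^ v)) (e :: l) = (e.2 : ℝ) * g (e.1 + Bs ^ v) + evalC (fun c => g (c + Bs ^ v)) l := fun v => by
      unfold evalC; rw [List.map_cons, List.sum_cons]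
    rw [h1]; simp only [h2]; rw [List.sum_map_add]

/-- `tabU (n+1)` is one step of `tabU n`. -/
theorem tabU_succ (Bs A X B Y t n : ℕ) : tabU Bs A X B Y t (n + 1) = stepU Bs (cellsAt A X B Y t n) (tabU Bs A X B Y t n) := rfl

/-- **The merged table**: equal codes summed after every relay. -/
def tabM (Bs A X B Y t fuel : ℕ) : ℕ → List (ℕ × ℤ)
  | 0 => [(0, 1)]
  | n + 1 => aggr (msort2 fuel (stepU Bs (cellsAt A X B Y t n) (tabM Bs A X B Y t fuel n)))

/-- Steps respect equality of evaluations. -/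
theorem evalC_stepU_congr (Bs : ℕ) (cells : List ℕ) {l l' : List (ℕ × ℤ)} (h : ∀ g : ℕ → ℝ, evalC g l = evalC g l') (g : ℕ → ℝ) :
    evalC g (stepU Bs cells l) = evalC g (stepU Bs cells l') := by
  rw [evalC_stepU, evalC_stepU]
  exact congrArg List.sum (List.map_congr_left fun v _ => h _)

/-- **The merged table evaluates like the unmerged one.** -/
theorem evalC_tabM (Bs A X B Y t fuel : ℕ) : ∀ (n : ℕ) (g : ℕ → ℝ), evalC g (tabM Bs A X B Y t fuel n) = evalC g (tabU Bs A X B Y t n)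
  | 0, g => rfl
  | n + 1, g => by
    rw [tabM, tabU_succ, evalC_aggr, evalC_perm g (msort2_perm fuel _)]
    exact evalC_stepU_congr Bs _ (fun g' => evalC_tabM Bs A X B Y t fuel n g') g

/-- Hence the counting lemma with the merged table. -/
theorem cylSum_eq_evalC_tabM (Bs A X B Y t fuel n : ℕ) (g : ℕ → ℝ) : cylSum Bs A X B Y t n g = evalC g (tabM Bs A X B Y t fuel n) := by
  rw [evalC_tabM, cylSum_eq_evalC_tabU]

/-! ### One varying slot (multiplier and marginal entries) -/

/-- The cells relay `x` may contribute when only the first slot varies over the cylinder `(A, X)` and the slots `a`, `b` are fixed. -/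
def cellsAtF (A X a b x : ℕ) : List ℕ := (allowedBits A X x).map fun b₁ => (4 * b₁ + 2 * cond (tb a x) 1 0) + cond (tb b x) 1 0

/-- The merged one-slot table. -/
def tabF (Bs A X a b fuel : ℕ) : ℕ → List (ℕ × ℤ)
  | 0 => [(0, 1)]
  | n + 1 => aggr (msort2 fuel (stepU Bs (cellsAtF A X a b n) (tabF Bs A X a b fuel n)))

/-- The one-slot cylinder sum. -/
noncomputable def fixSum (Bs A X a b n : ℕ) (g : ℕ → ℝ) : ℝ := ((cylR n A X).map fun K => g (cvcode Bs n K a b)).sum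

/-- The new relay's cell with one varying slot. -/
theorem cell_fix (K a b n b₁ : ℕ) (h₁ : tb K n = decide (b₁ = 1)) (hb₁ : b₁ ≤ 1) :
    cell K a b n = (4 * b₁ + 2 * cond (tb a n) 1 0) + cond (tb b n) 1 0 := by
  unfold cell; rw [h₁]
  interval_cases b₁ <;> cases tb a n <;> cases tb b n <;> simp

/-- **The one-slot counting lemma.** -/
theorem fixSum_eq_evalC_tabF (Bs A X a b fuel : ℕ) : ∀ (n : ℕ) (g : ℕ → ℝ), fixSum Bs A X a b n g = evalC g (tabF Bs A X a b fuel n)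
  | 0, g => by simp [fixSum, cylR, cylB, cvcode, tabF, evalC]
  | n + 1, g => by
    have IH := fixSum_eq_evalC_tabF Bs A X a b fuel n
    rw [tabF, evalC_aggr, evalC_perm g (msort2_perm fuel _), evalC_stepU]
    unfold fixSum
    rw [cylR_succ' n A X, sum_map_flatMap]
    unfold cellsAtF
    rw [List.map_map]
    refine congrArg List.sum (List.map_congr_left fun b₁ hb₁ => ?_)
    have hb₁' := le_one_of_mem_allowedBits hb₁
    rw [List.map_map]
    simp only [Function.comp]
    rw [← IH]
    unfold fixSum
    refine congrArg List.sum (List.map_congr_left fun K hK => ?_)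
    have hs := cvcode_shift Bs n K a b b₁ 0 hb₁' (by norm_num)
    rw [zero_mul, zero_add] at hs
    simp only [Function.comp]
    rw [cvcode_succ, hs, cell_fix _ a b n b₁ (tb_bit_shift n K b₁ (lt_of_mem_cylR hK) hb₁') hb₁']

/-! ### Bridges: enumeration lists are cylinders -/

/-- All patterns: `cylR m 0 0 = range 2^m`. -/
theorem cylR_zero_zero (m : ℕ) : cylR m 0 0 = List.range (2 ^ m) := by
  unfold cylR
  rw [List.filter_eq_self]
  intro K _
  unfold cylB
  rw [List.all_eq_true]
  intro x _
  simp [tb_eq]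

/-- `land` equations, bitwise. -/
theorem land_eq_self_iff (K X : ℕ) : K &&& X = X ↔ ∀ y, X.testBit y = true → K.testBit y = true := by
  constructor
  · intro h y hy
    have := congrArg (fun n => n.testBit y) h
    simp only [Nat.testBit_and, hy, Bool.and_true] at this
    exact this
  · intro h
    refine Nat.eq_of_testBit_eq fun y => ?_
    rw [Nat.testBit_and]
    cases hX : X.testBit y
    · simp
    · simp [h y hX]

/-- `land` vanishing, bitwise. -/
theorem land_eq_zero_iff (K A : ℕ) : K &&& A = 0 ↔ ∀ y, A.testBit y = true → K.testBit y = false := by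
  constructor
  · intro h y hy
    have := congrArg (fun n => n.testBit y) h
    simp only [Nat.testBit_and, hy, Bool.and_true, Nat.zero_testBit] at this
    exact this
  · intro h
    refine Nat.eq_of_testBit_eq fun y => ?_
    rw [Nat.testBit_and, Nat.zero_testBit]
    cases hA : A.testBit y
    · simp
    · simp [h y hA]

/-- **The cylinder membership of `…QCert` is `cylB`** for patterns `K < 2^m` when `X < 2^m`. -/
theorem cylMem_eq_cylB (m A X K : ℕ) (hK : K < 2 ^ m) (hX : X < 2 ^ m) : cylMem m A X K = cylB m A X K := by
  rw [Bool.eq_iff_iff]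
  unfold cylMem cylB
  rw [Bool.and_eq_true, Bool.and_eq_true, Nat.blt_eq, Nat.beq_eq, Nat.beq_eq, List.all_eq_true,
    show Nat.land K X = K &&& X from rfl, show Nat.land K A = K &&& A from rfl, land_eq_self_iff, land_eq_zero_iff]
  constructor
  · rintro ⟨⟨_, hx⟩, ha⟩ y _
    rw [tb_eq, tb_eq, tb_eq]
    cases hAy : A.testBit y <;> cases hXy : X.testBit y
    · simp
    · simp [hx y hXy]
    · simp [ha y hAy]
    · have h1 := ha y hAy
      have h2 := hx y hXy
      rw [h1] at h2
      exact absurd h2 (by simp)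
  · intro h
    refine ⟨⟨hK, fun y hy => ?_⟩, fun y hy => ?_⟩
    · by_cases hym : y < m
      · have := h y (List.mem_range.mpr hym)
        rw [tb_eq, tb_eq, tb_eq, hy] at this
        revert this
        cases K.testBit y <;> cases A.testBit y <;> simp
      · exfalso
        have : X < 2 ^ y := lt_of_lt_of_le hX (Nat.pow_le_pow_right (by norm_num) (by omega))
        rw [Nat.testBit_lt_two_pow this] at hy
        exact Bool.false_ne_true hy
    · by_cases hym : y < m
      · have := h y (List.mem_range.mpr hym)
        rw [tb_eq, tb_eq, tb_eq, hy] at this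
        revert this
        cases K.testBit y <;> cases X.testBit y <;> simp
      · have : K < 2 ^ y := lt_of_lt_of_le hK (Nat.pow_le_pow_right (by norm_num) (by omega))
        exact Nat.testBit_lt_two_pow this

/-- `suppOf (2^m + 1)` of a predicate false at `2^m` is the filter of `range 2^m`. -/
theorem suppOf_NV (m : ℕ) (P : ℕ → Bool) (hD : P (2 ^ m) = false) : suppOf (2 ^ m + 1) P = (List.range (2 ^ m)).filter P := by
  unfold suppOf
  rw [List.range_succ, List.filter_append, List.filter_singleton, hD]
  simp

/-- **A validated row mask lists exactly the cylinder** (hypotheses as delivered by `maskOK`/`rowOK`). -/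
theorem suppOf_mask_eq_cylR (m A X mk : ℕ) (hmk : mk < 2 ^ 2 ^ m) (hX : X < 2 ^ m) (hall : ∀ K < 2 ^ m, tb mk K = cylMem m A X K) :
    suppOf (2 ^ m + 1) (tb mk) = cylR m A X := by
  rw [suppOf_NV m _ (by rw [tb_eq, Nat.testBit_lt_two_pow hmk])]
  unfold cylR
  exact List.filter_congr fun K hK => by
    rw [hall K (List.mem_range.mp hK), cylMem_eq_cylB m A X K (List.mem_range.mp hK) hX]

/-- `maskOK` delivers the hypotheses of `suppOf_mask_eq_cylR`. -/
theorem maskOK_spec (c : Cert) (A X mk : ℕ) (h : c.maskOK A X mk = true) :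
    mk < 2 ^ 2 ^ c.m ∧ ∀ K < 2 ^ c.m, tb mk K = cylMem c.m A X K := by
  unfold Cert.maskOK at h
  rw [Bool.and_eq_true, Nat.blt_eq, List.all_eq_true] at h
  refine ⟨h.1, fun K hK => ?_⟩
  have := h.2 K (List.mem_range.mpr hK)
  cases htb : tb mk K <;> rw [htb] at this <;> simpa using this

/-- **The patterns containing relay `x < m` are the cylinder `(0, 2^x)`.** -/
theorem suppOf_marg_eq_cylR (m x : ℕ) (hx : x < m) :
    suppOf (2 ^ m + 1) (fun K => decide (K < 2 ^ m) && tb K x) = cylR m 0 (2 ^ x) := by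
  rw [suppOf_NV m _ (by simp)]
  unfold cylR
  refine List.filter_congr fun K hK => ?_
  have hKm := List.mem_range.mp hK
  rw [decide_eq_true hKm, Bool.true_and]
  unfold cylB
  rw [Bool.eq_iff_iff, List.all_eq_true]
  constructor
  · intro h y hy
    rw [tb_eq 0, Nat.zero_testBit, tb_eq (2 ^ x), Nat.testBit_two_pow]
    by_cases hxy : x = y
    · subst hxy; simp [h]
    · simp [hxy]
  · intro h
    have := h x (List.mem_range.mpr hx)
    rw [tb_eq 0, Nat.zero_testBit, tb_eq (2 ^ x), Nat.testBit_two_pow_self] at this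
    revert this
    cases tb K x <;> simp

/-- **The patterns with at least `h` relays cut are the popcount filter of all patterns.** -/
theorem suppOf_tMem_eq (m h : ℕ) :
    suppOf (2 ^ m + 1) (fun K => decide (K < 2 ^ m) && decide (h ≤ popc m K)) = (cylR m 0 0).filter fun K => decide (h ≤ popc m K) := by
  rw [suppOf_NV m _ (by simp), cylR_zero_zero]
  exact List.filter_congr fun K hK => by rw [decide_eq_true (List.mem_range.mp hK), Bool.true_and]

/-- A filtered sum is a sum with an indicator. -/
theorem sum_map_filter (l : List ℕ) (P : ℕ → Bool) (f : ℕ → ℝ) :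
    ((l.filter P).map f).sum = (l.map fun x => if P x then f x else 0).sum := by
  induction l with
  | nil => simp
  | cons a l ih => rw [List.filter_cons]; cases hP : P a <;> simp [hP, ih]

end QCert
end HubOnly

end Summit.CriticalPhenomena.PercolationContinuityZ3.Theorems
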